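import Summits.MatrixMultiplication.OmegaCensus.SmallFormats.MatMul22nLoadedPlaneCensus
import HarnessLib

/-!
# ω-census family (a): two more census clauses at length `3n + 3` over `𝔽₃` — the digit cap and the frame cap `4` on every rank-one plane

Cell `pub-omega` (unit `pub-omega-tensor`, gen 39), topic `Summits/MatrixMultiplication/OmegaCensus` (sub-folder
`SmallFormats`). Framing (verbatim): lottery ticket; floor = certified bounds/negative ranges. HONEST FRAMING: bookkeeping for the
successor's branch-and-bound certificate «(9,30): census clauses ⇒ the count vector is one of the 25 all-4 completions» (tensor g39 memo
ALL4-SAT-g39 §6): two hypotheses of that certificate written on the count vector `cnt (xMarginal β)` over tensor g31's 40 classes.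
Nothing here is a bound on any rank; nothing on `ω`.

* `Enum723.cnt_add_three_mul_le` — the DIGIT cap (`𝔽₃`, any `(n, r)`): `cnt (xMarginal β) a + 3n ≤ r` for every class `a < 40`
  (from the point cap `XCaps3.1`: all terms whose coefficient matrix is `±` class `a` are multiples of `clsM a`).
* `Enum723.load_rowcol_le_four_3n3` — the FRAME cap (`𝔽₃`, length `3n+3`, `n ≥ 8`): `load (cnt (xMarginal β)) k ≤ 4` for every
  row/column clause `k ∈ [32, 40)` (tensor g38's `FramePlaneCap.card_le_four_of_vecMul_eq_zero_3m3 / _mulVec_` (p716980, any field) in census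
  coordinates).
-/

namespace Summit.MatrixMultiplication.OmegaCensus.SmallFormats

open Finset Matrix
open Literature.Computability.AlgebraicComplexity
open Summit.MatrixMultiplication.OmegaCensus.RankOnePlaneCapGeneral

namespace Enum723

/-- **Digit cap in census coordinates** (`𝔽₃`): `cnt (xMarginal β) a + 3n ≤ r` for every class `a < 40`. -/
theorem cnt_add_three_mul_le {n r : ℕ} (β : BilinComp (mulBilin (ZMod 3) 2 2 n) (Fin r)) (a : ℕ) (ha : a < 40) :
    cnt (xMarginal β) a + 3 * n ≤ r := by
  classical
  obtain ⟨hpt, -, -, -, -, -, -, -⟩ := xCaps3_xMarginal β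
  have hne : clsM a ≠ 0 := fun h => by
    have h1 := isCls_nonzero (clsF a) a ha (Or.inl rfl)
    rw [← mflat_clsM, h] at h1
    exact absurd h1 (by decide)
  have h := hpt (clsM a) hne
  have hsub : (Finset.univ.filter fun i => IsCls (mflat (xMarginal β i)) a) ⊆
      Finset.univ.filter fun i => ∃ c : ZMod 3, xMarginal β i = c • clsM a := by
    intro i hi
    rw [Finset.mem_filter] at hi ⊢
    refine ⟨hi.1, ?_⟩
    rcases hi.2 with h' | h'
    · exact ⟨1, by rw [one_smul]; exact mflat_injective (by rw [h', mflat_clsM])⟩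
    · exact ⟨-1, mflat_injective (by rw [h']; funext b; simp [mflat, clsM])⟩
  have hle := Finset.card_le_card hsub
  rw [cnt]; omega

/-- **Frame cap `4` on every rank-one ROW/COLUMN plane in census coordinates** (`𝔽₃`, length `3n+3`, `n ≥ 8`): `load (cnt (xMarginal β)) k ≤ 4`
for `k ∈ [32, 40)`. -/
theorem load_rowcol_le_four_3n3 {n : ℕ} (hn : 8 ≤ n) (β : BilinComp (mulBilin (ZMod 3) 2 2 n) (Fin (3 * n + 3)))
    (hm : ∀ i, xMarginal β i ≠ 0) (k : ℕ) (hk1 : 32 ≤ k) (hk2 : k < 40) : load (cnt (xMarginal β)) k ≤ 4 := by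
  classical
  rw [← card_filter_csem (xMarginal β) hm k (by omega)]
  have h1 : ¬ k < 32 := by omega
  by_cases h2 : k < 36
  · have e : (Finset.univ.filter fun i => csem k (mflat (xMarginal β i))) =
        Finset.univ.filter fun i => Matrix.vecMul (lamF (k - 32)) (xMarginal β i) = 0 := by
      congr 1; ext i; simp only [csem, if_neg h1, if_pos h2, vecMul_eq_zero_iff, mflat_apply]
    rw [e]
    exact FramePlaneCap.card_le_four_of_vecMul_eq_zero_3m3 hn β (Fintype.card_fin _) (lamF (k - 32))
      (lamF_ne _ (by omega)) _ fun i hi => (Finset.mem_filter.mp hi).2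
  · have e : (Finset.univ.filter fun i => csem k (mflat (xMarginal β i))) =
        Finset.univ.filter fun i => Matrix.mulVec (xMarginal β i) (lamF (k - 36)) = 0 := by
      congr 1; ext i; simp only [csem, if_neg h1, if_neg h2, if_pos hk2, mulVec_eq_zero_iff, mflat_apply]
    rw [e]
    exact FramePlaneCap.card_le_four_of_mulVec_eq_zero_3m3 hn β (Fintype.card_fin _) (lamF (k - 36))
      (lamF_ne _ (by omega)) _ fun i hi => (Finset.mem_filter.mp hi).2

end Enum723

end Summit.MatrixMultiplication.OmegaCensus.SmallFormats
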